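import Summits.ABC.IUTFork.Joshi.TestThetaLoci
import Summits.ABC.IUTFork.Joshi.TestIsmScalingResults
import HarnessLib

/-!
# X-09 × X-07′ — the theta-values-loci dictionary rows (D-09 / D-11) at the JOSHI-STYLE (Ind2) model `scalSetting`:
# the ⊆-rows are VACUOUS, print's «are» (⊇ half) FAILS for every bounded locus, while S HOLDS

Proof-only record file of the abc-iut cell, branch E (rung LADDER-ABC:A2.E; seat abc-iut-E-t56 — [J-III] lane-B typer-side reader;
cross offered on STATUS 2026-08-26T09:02Z to the row owners abc-iut-E-t22 (X-09, `Joshi/TestThetaLoci.lean` p431723) and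
abc-iut-E-t41 (X-07′, `Joshi/TestIsmScaling*.lean`), decls of both used BY NAME; plan/E/E-PLAN.md R13: evaluations of this kind are
«J-FALSE-AT-…» DATA for the test ledger, NOT verdicts; E-cx places them). **No side is taken** on [IUTchIII] Cor. 3.12, on Joshi's
claims (K. Joshi, arXiv:2401.13508v4 = [J-III], unrefereed) or on Mochizuki's report on them; typed ≠ proved; a model EXHIBITS
(non-)satisfiability of typed hypotheses, nothing more.

THE THIRD MODEL FAMILY. X-09 (p431723) evaluated the rows of `Joshi/DictionaryThetaLoci.lean` (p429683: `LocusWithinPossibleImages` /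
`PossibleImagesWithinLocus` = the two halves of Thm-Def 9.8.1.1 (7) p.116 l.43–50 «are Mochizuki's multi-radial representations of
Theta-values», `LocusWithinHull` = what (xi-f) consumes, OUR READINGS `StdDatumWithinLocus` / `GeneratorsReadAsData`) at the FLOOR and
at the PINNED countermodel of record — both with (Ind1)/(Ind2) acting by ISOMETRIES, so that the possible images are ONE ball and S
fails at the pin. Here the same rows are evaluated at abc-iut-E-t41's `IsmScaling.scalSetting p` (X-07′): the pinned carriers with
`LogShells.ism` enlarged to ALL ℚ-linear automorphisms («ℚ_p-linear isomorphisms σ», [J-III] §8.11.1 p.91 l.44–46), where S =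
`PilotKummerIndRelated` HOLDS (`scalSetting_pilotKummerIndRelated`), the possible images at `j ∈ 𝔽_l^⋆` are ALL the balls
(`scalSetting_possibleImages`), their union is the WHOLE packet line (`scalSetting_sUnion_possibleImages`) and no hull-set contains it
(`scalSetting_escapes`).

RESULTS (kernel, logic only over landed decls):
* §1 `scalSetting_thetaHull_eq_univ`: the typed holomorphic hull `^{n,∘}𝒰_{j,v_ℚ}` is the whole line (the frame's «𝓘^ℚ((−)) otherwise»
  branch); `scalSetting_sUnion_possibleImages_all` (all labels).
* §2 for EVERY loci signature `C`, dictionary `𝔇` and reading `R : LociReading (scalSetting p) C 𝔇`: `LocusWithinPossibleImages` and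
  `LocusWithinHull` hold VACUOUSLY (`scal_locusWithinPossibleImages`, `scal_locusWithinHull`); `PossibleImagesWithinLocus ↔` the locus
  read in EVERY packet is the whole line (`scal_possibleImagesWithinLocus_iff`); hence it FAILS as soon as one packet shadow of the locus
  at a label of `𝔽_l^⋆` lies in a ball (`scal_not_possibleImagesWithinLocus_of_subset_pBall`) — e.g. for any reading honouring Joshi's
  Cor. 9.8.1.3 «contained in a compact subset» (p.116 l.63 – p.117 l.4) in the p-adic sense.
* §3 the two readings of p431723 transplanted (E-t22's `regionLoci`/`regionReading`, move-free dictionaries of p429619):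
  Θ-reading (locus = `B_{j²}`): ⊆-rows ∧ `StdDatumWithinLocus` hold, `PossibleImagesWithinLocus` FAILS, S holds (`scal_theta_profile`);
  q-reading (locus = `B_1`): `StdDatumWithinLocus ∧ StandardPointIsQPilot ∧ LocusWithinHull` hold TOGETHER (at the pin this triple was
  UNSATISFIABLE, p430545) and the (xi-f) `Licence` holds, yet the typed Statement FAILS — the hull-level chain of p429683
  (`statement_of_locusWithinHull`) is blocked exactly at `BridgeHyps` (`finite`), as X-07′'s census says (`scal_q_profile`).
LOCATED SENTENCE (for E-cx's X-09 row; no verdict): «across the cell's three model families the identification row D-11 (both halves)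
and S are never jointly and non-trivially true: with an isometric (Ind2) print's «are» can hold (pinned Θ-reading) but S fails; with
Joshi's rescaling (Ind2) S holds but the multiradial orbit is the whole packet line, so a bounded (compact) Joshi locus cannot BE it and
the ⊆-rows carry no content.» [claim: Joshi2024ATS3, status: disputed] [claim: Mochizuki2012, status: disputed]
-/

noncomputable section

open Set

namespace Summit.ABC.IUTFork.Joshi

open Thm311 Cor312 Cor312.Checks Cor312.IdentifiedNonVacuity Cor312Vol Cor312Vol.NaiveWitness Cor312Vol.PinnedWitness IsmScaling

variable (p : ℕ) [hp : Fact p.Prime]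

/-! ## 1. At `scalSetting` the orbit fills the line and the typed hull is everything -/

/-- The union of the possible images at a label of `𝔽_l^⋆` is NOT relatively compact in the ball frame: every hull-set `B_K` misses the
possible image `B_{K−1}` (X-07′ `scalSetting_escapes`). [folklore] -/
theorem scalSetting_not_isBounded_sUnion (i : Fin toyIndex.lstar) (vQ : toyIndex.VQ) :
    ¬ ((scalSetting p).frame (Setting.labelSucc i) vQ).IsBounded (⋃₀ (scalSetting p).possibleImages (Setting.labelSucc i) vQ) := by
  intro hb
  obtain ⟨H, hH, hsub⟩ := ((scalSetting p).frame _ vQ).exists_hul _ hb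
  obtain ⟨U, hU, hUH⟩ := scalSetting_escapes p i vQ H hH
  exact hUH ((subset_sUnion_of_mem hU).trans hsub)

/-- **The typed holomorphic hull `^{n,∘}𝒰_{j,v_ℚ}` at `scalSetting` is the WHOLE packet line** ([IUTchIII] Rmk. 3.9.5 (i) «𝓘^ℚ((−))
otherwise», the `else` branch of `HullFrame.hull`). [folklore] -/
theorem scalSetting_thetaHull_eq_univ (i : Fin toyIndex.lstar) (vQ : toyIndex.VQ) :
    (scalSetting p).thetaHull (Setting.labelSucc i) vQ = univ := by
  rw [Setting.thetaHull, HullFrame.hull, if_neg (scalSetting_not_isBounded_sUnion p i vQ)]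

/-- The union of the possible images is the whole packet at EVERY label (at `j = 0` by the zero-label convention). [folklore] -/
theorem scalSetting_sUnion_possibleImages_all (j : toyIndex.Label) (vQ : toyIndex.VQ) :
    ⋃₀ (scalSetting p).possibleImages j vQ = univ := by
  by_cases hj : j = 0
  · subst hj; rw [scalSetting_possibleImages_zero, sUnion_singleton]
  · exact scalSetting_sUnion_possibleImages p hj vQ

/-! ## 2. The D-11 rows for an ARBITRARY reading at `scalSetting` -/

section AnyReading

variable {W : Type} {V : W → Type} [∀ w, TopologicalSpace (V w)] {TJ TM : Type} [TopologicalSpace TJ] [TopologicalSpace TM]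
  {C : ATS3.TensorPacketLociDatum W V TJ TM} {𝔇 : Dictionary (scalFull p).toLatticeSituation}
  (R : LociReading (scalSetting p) C 𝔇)

/-- **`LocusWithinPossibleImages` holds VACUOUSLY at `scalSetting`** for every reading (the union of the possible images is the whole
line). [folklore] -/
theorem scal_locusWithinPossibleImages : R.LocusWithinPossibleImages := fun j vQ => by
  rw [scalSetting_sUnion_possibleImages_all]; exact subset_univ _

/-- **`LocusWithinHull` holds VACUOUSLY at `scalSetting`** for every reading (the typed hull is the whole line). [folklore] -/
theorem scal_locusWithinHull : R.LocusWithinHull := fun i vQ => by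
  rw [scalSetting_thetaHull_eq_univ]; exact subset_univ _

/-- **Print's «are», ⊇ half, at `scalSetting`**: `PossibleImagesWithinLocus` ⟺ Joshi's locus read in EVERY packet is the whole line.
[folklore] -/
theorem scal_possibleImagesWithinLocus_iff :
    R.PossibleImagesWithinLocus ↔ ∀ (j : toyIndex.Label) (vQ : toyIndex.VQ), R.locusRegion j vQ = univ := by
  refine forall_congr' fun j => forall_congr' fun vQ => ?_
  rw [scalSetting_sUnion_possibleImages_all, univ_subset_iff]

/-- … hence it FAILS for every reading one of whose packet shadows lies in a ball `B_K` (any bounded / «compact», Cor. 9.8.1.3, reading of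
Joshi's locus in the p-adic line). J-FALSE-AT-`scalSetting` data (R13), logic only. [claim: Joshi2024ATS3, status: disputed] -/
theorem scal_not_possibleImagesWithinLocus_of_subset_pBall {j : toyIndex.Label} (vQ : toyIndex.VQ) (K : ℤ)
    (h : R.locusRegion j vQ ⊆ pBall p j vQ K) : ¬ R.PossibleImagesWithinLocus := fun hP =>
  pBall_ne_univ p j vQ K (univ_subset_iff.1 (((scal_possibleImagesWithinLocus_iff p R).1 hP j vQ) ▸ h))

/-- So at `scalSetting` BOTH halves of print's «are» hold iff the locus is read as the whole line in every packet — the identification is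
either false or content-free there. [folklore] -/
theorem scal_locusRegion_eq_univ_of_both (h₂ : R.PossibleImagesWithinLocus) (j : toyIndex.Label) (vQ : toyIndex.VQ) :
    R.locusRegion j vQ = univ :=
  (R.locusRegion_eq_of_both (scal_locusWithinPossibleImages p R) h₂ j vQ).trans (scalSetting_sUnion_possibleImages_all p j vQ)

end AnyReading

/-! ## 3. The Θ-reading and the q-reading of p431723 transplanted to `scalSetting` -/

omit hp in
/-- The line's Θ-datum at `scalSetting` is w5-d247's `Ψ_v = {(±q^{j²})_j}`. [folklore] -/
theorem scal_thetaDatum : ((scalFull p).toLatticeSituation.D (scalSetting p).n).Ψ = fun v _ => Psi p v := rfl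

/-- Θ-reading dictionary at `scalSetting`: move-free, datum `Ψ_n` (p429619 `constDictionary`). [folklore] -/
abbrev scalThetaDictionary : Dictionary (scalFull p).toLatticeSituation :=
  constDictionary (scalFull p).toLatticeSituation ((scalFull p).toLatticeSituation.D (scalSetting p).n).Ψ

/-- q-reading dictionary at `scalSetting`: move-free, datum the q-pilot's Kummer datum `qDatum`. [folklore] -/
abbrev scalQDictionary : Dictionary (scalFull p).toLatticeSituation :=
  constDictionary (scalFull p).toLatticeSituation (PinnedWitness.qDatum p)

/-- The Θ-datum's regions: `univ` at `j = 0`, `B_{j²}` at `j ∈ 𝔽_l^⋆` (X-07′ `scalRegion_Psi`). [folklore] -/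
theorem scal_thetaRegion_eq (j : toyIndex.Label) (vQ : toyIndex.VQ) :
    scalRegion p ((scalThetaDictionary p).datum (scalThetaDictionary p).std) j vQ = if j = 0 then univ else pBall p j vQ (jsq j) := by
  show scalRegion p (fun v _ => Psi p v) j vQ = _
  exact scalRegion_Psi p j vQ

/-- … hence non-empty. [folklore] -/
theorem scal_thetaRegion_nonempty (j : toyIndex.Label) (vQ : toyIndex.VQ) :
    (scalRegion p ((scalThetaDictionary p).datum (scalThetaDictionary p).std) j vQ).Nonempty := by
  rw [scal_thetaRegion_eq]
  split_ifs
  · exact univ_nonempty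
  · exact ⟨0, zero_mem_pBall p j vQ _⟩

/-- The q-datum's regions: `univ` at `j = 0`, `B_1` at `j ∈ 𝔽_l^⋆` (X-07′ `scalRegion_qDatum`). [folklore] -/
theorem scal_qRegion_eq (j : toyIndex.Label) (vQ : toyIndex.VQ) :
    scalRegion p ((scalQDictionary p).datum (scalQDictionary p).std) j vQ = if j = 0 then univ else pBall p j vQ 1 := by
  show scalRegion p (PinnedWitness.qDatum p) j vQ = _
  by_cases hj : j = 0
  · subst hj; rw [if_pos rfl, scalRegion_zero]
  · rw [if_neg hj, scalRegion_qDatum p hj]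

/-- … hence non-empty. [folklore] -/
theorem scal_qRegion_nonempty (j : toyIndex.Label) (vQ : toyIndex.VQ) :
    (scalRegion p ((scalQDictionary p).datum (scalQDictionary p).std) j vQ).Nonempty := by
  rw [scal_qRegion_eq]
  split_ifs
  · exact univ_nonempty
  · exact ⟨0, zero_mem_pBall p j vQ _⟩

/-- The Θ-reading of Joshi's locus at `scalSetting` (E-t22's toy region signature; DEGENERATE as labelled there). [folklore] -/
abbrev scalThetaReading :
    LociReading (scalSetting p) (regionLoci (scalFull p).toLatticeSituation _ (scal_thetaRegion_nonempty p)) (scalThetaDictionary p) :=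
  regionReading (scalFull p).toLatticeSituation _ (scal_thetaRegion_nonempty p) (scalThetaDictionary p)

/-- The q-reading of Joshi's locus at `scalSetting`. [folklore] -/
abbrev scalQReading :
    LociReading (scalSetting p) (regionLoci (scalFull p).toLatticeSituation _ (scal_qRegion_nonempty p)) (scalQDictionary p) :=
  regionReading (scalFull p).toLatticeSituation _ (scal_qRegion_nonempty p) (scalQDictionary p)

/-- **X-09 at X-07′, Θ-reading**: the ⊆-rows and the concordance hold, the ⊇ half of print's «are» FAILS (the locus `B_{j²}` is one ball,
the orbit is every ball), and S HOLDS at this setting (X-07′ (a)). Contrast p431723 `pinned_theta_split`: there BOTH halves of «are» held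
and S failed. [claim: Joshi2024ATS3, status: disputed] -/
theorem scal_theta_profile :
    (scalThetaReading p).LocusWithinPossibleImages ∧ (scalThetaReading p).LocusWithinHull ∧
      (scalThetaReading p).StdDatumWithinLocus (scalRegion p) ∧ ¬ (scalThetaReading p).PossibleImagesWithinLocus ∧
      PilotKummerIndRelated (scalFull p).toLatticeSituation (scalSetting p) (scalRegion p) (PinnedWitness.qDatum p) := by
  refine ⟨scal_locusWithinPossibleImages p _, scal_locusWithinHull p _,
    datum_stdDatumWithinLocus _ (scalThetaDictionary p) (scalRegion p) (scal_thetaRegion_nonempty p), ?_,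
    scalSetting_pilotKummerIndRelated p⟩
  have h : (scalThetaReading p).locusRegion (Setting.labelSucc ⟨0, by decide⟩) () =
      pBall p (Setting.labelSucc ⟨0, by decide⟩) () (jsq (Setting.labelSucc ⟨0, by decide⟩)) := by
    rw [locusRegion_regionReading, scal_thetaRegion_eq, if_neg (Setting.labelSucc_ne_zero _)]
  exact scal_not_possibleImagesWithinLocus_of_subset_pBall p _ () _ h.subset

/-- **X-09 at X-07′, q-reading**: `StdDatumWithinLocus ∧ StandardPointIsQPilot ∧ LocusWithinHull` hold TOGETHER (at the pinned
countermodel this triple is UNSATISFIABLE, p430545 `locusWithinHull_pinned_forces`), the (xi-f) `Licence` holds, the ⊇ half of «are»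
FAILS, S HOLDS — and the typed Statement FAILS with the bridge hypotheses (X-07′ (b′)): the hull-level chain of p429683 is blocked exactly
at `BridgeHyps`. [claim: Joshi2024ATS3, status: disputed] -/
theorem scal_q_profile :
    (scalQReading p).StdDatumWithinLocus (scalRegion p) ∧
      StandardPointIsQPilot (scalRegion p) (PinnedWitness.qDatum p) (scalQDictionary p) ∧
      (scalQReading p).LocusWithinHull ∧ Thm311ToCor312.Licence (scalSetting p) ∧
      ¬ (scalQReading p).PossibleImagesWithinLocus ∧
      PilotKummerIndRelated (scalFull p).toLatticeSituation (scalSetting p) (scalRegion p) (PinnedWitness.qDatum p) ∧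
      ¬ (scalSetting p).Statement ∧ ¬ BridgeHyps (scalSetting p) := by
  refine ⟨datum_stdDatumWithinLocus _ (scalQDictionary p) (scalRegion p) (scal_qRegion_nonempty p),
    const_q_standardPointIsQPilot _ _ _, scal_locusWithinHull p _, scalSetting_licence p, ?_,
    scalSetting_pilotKummerIndRelated p, scalSetting_not_statement_not_bridgeHyps p⟩
  have h : (scalQReading p).locusRegion (Setting.labelSucc ⟨0, by decide⟩) () =
      pBall p (Setting.labelSucc ⟨0, by decide⟩) () 1 := by
    rw [locusRegion_regionReading, scal_qRegion_eq, if_neg (Setting.labelSucc_ne_zero _)]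
  exact scal_not_possibleImagesWithinLocus_of_subset_pBall p _ () _ h.subset

/-- **X-09 across the model families, packaged** (located, no verdict): at the pinned countermodel (isometric (Ind2)) the Θ-reading has BOTH
halves of «are» and ¬S (p431723); at `scalSetting` (rescaling (Ind2)) S holds while the ⊇ half FAILS for the Θ-reading and for the
q-reading alike — the identification row and S are not jointly and non-trivially realised in the cell's models. [claim: Joshi2024ATS3, status: disputed] -/
theorem loci_rows_vs_S_located :
    ((pinnedThetaReading p).LocusWithinPossibleImages ∧ (pinnedThetaReading p).PossibleImagesWithinLocus ∧
        ¬ PilotKummerIndRelated (naiveFull p).toLatticeSituation (pinnedSetting p) (orbitRegion p) (PinnedWitness.qDatum p)) ∧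
      (PilotKummerIndRelated (scalFull p).toLatticeSituation (scalSetting p) (scalRegion p) (PinnedWitness.qDatum p) ∧
        ¬ (scalThetaReading p).PossibleImagesWithinLocus ∧ ¬ (scalQReading p).PossibleImagesWithinLocus) :=
  ⟨⟨(pinned_theta_split p).1, (pinned_theta_split p).2.1, pinnedSetting_not_pilotKummerIndRelated p⟩,
    ⟨scalSetting_pilotKummerIndRelated p, (scal_theta_profile p).2.2.2.1, (scal_q_profile p).2.2.2.2.1⟩⟩

end Summit.ABC.IUTFork.Joshi

end
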